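import Literature.NumberTheory.LFunctions.ConreyVRightEdge
import Literature.Analysis.Complex.BacklundArgVariation
import HarnessLib

/-!
# Conrey's `V` on the horizontal edges: `|Δ arg V(σ + iT)|_{½ ≤ σ ≤ 5/2} = O(log T)` (Backlund)

Topic `Literature/NumberTheory/LFunctions`. Everything here is PROVED; there are no definitions
and no named facts.

The horizontal-edge terms of the argument principle for Conrey's function
`V = 𝜙(−δ/L)𝓡 + χ · 𝜙(1 − δ/L)K` (`Literature.NumberTheory.LFunctions.conreyV`) on the rectangles
`[½, 5/2] × [T₁, T₂]` of Levinson's method (Conrey, J. Number Theory 16 (1983), §4 (3): "by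
Jensen's theorem in a familiar way") are `O(log T)`. We run Backlund's lemma
(`Literature.Analysis.Complex.abs_im_integral_logDeriv_le_backlund`, discs `|z − (5/2 + iT)| ≤ 5/2`
and `≤ 2`) with:

* `analyticAt_conreyV_of_im_ne_zero` — `V` is analytic off the real axis (the polynomial
  differential operators of the entire functions `𝓡`, `K` are entire; `χ` is analytic off the
  real axis, `Literature.NumberTheory.LFunctions.SiegelIntegral.analyticAt_rsChi_of_im_ne_zero`);
* `norm_conreyV_le_of_mem_closedBall` — **polynomial growth `‖V(z)‖ ≤ C_𝜙 T⁴` on the disc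
  `|z − (5/2 + iT)| ≤ 5/2`** (`L ≥ 1`, `T ≥ 1200π`), from the crude Riemann–Siegel bounds
  `Literature.NumberTheory.LFunctions.SiegelIntegral.norm_riemannAux_le_rpow` (Cauchy transfer
  on circles of radius `1`) and `‖χ(x+iy)‖ ≤ 15(2π)^x(y+½)`;
* the centre value `|V(5/2 + iT)| ≥ |𝜙(0)|/6` of `ConreyVRightEdge.lean`;

to get `conreyV_horizontal_argVariation`: **there are `L₀, T₀, C` such that for `L ≥ L₀`,
`T ≥ T₀` and `V ≠ 0` on `[½, 5/2] × {T}`,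
`|Im ∫_{1/2}^{5/2} (V'/V)(x + iT) dx| ≤ C log T`.**

## References

* J. B. Conrey, *Zeros of derivatives of Riemann's ξ-function on the critical line*, J. Number
  Theory 16 (1983), 49–74, §4 (3). [Conrey1983]
* E. C. Titchmarsh, *The Theory of the Riemann Zeta-Function*, 2nd ed. (1986), §9.4, §10.28.
  [Titchmarsh1986]
-/

noncomputable section

open Complex Polynomial Set Filter Topology Metric MeasureTheory
open scoped Real ComplexConjugate

namespace Literature.NumberTheory.LFunctions

open Literature.Analysis.Complex SiegelIntegral

/-- **`conreyV 𝜙 L` is analytic at every `s` with `Im s ≠ 0`.** [cite: Conrey1983, §4 (2)] -/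
theorem analyticAt_conreyV_of_im_ne_zero (φ : ℝ[X]) (L : ℝ) {s : ℂ} (hs : s.im ≠ 0) :
    AnalyticAt ℂ (conreyV φ L) s := by
  have h1 : AnalyticAt ℂ (polyDerivOp φ (-L⁻¹) riemannAux) s :=
    (differentiable_polyDerivOp _ _ differentiable_riemannAux).analyticAt s
  have h2 : AnalyticAt ℂ (polyDerivOp (φ.comp (1 - X)) L⁻¹ riemannAuxConj) s :=
    (differentiable_polyDerivOp _ _ differentiable_riemannAuxConj).analyticAt s
  have h : AnalyticAt ℂ (fun z ↦ polyDerivOp φ (-L⁻¹) riemannAux z +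
      rsChi z * polyDerivOp (φ.comp (1 - X)) L⁻¹ riemannAuxConj z) s :=
    h1.add ((analyticAt_rsChi_of_im_ne_zero hs).mul h2)
  exact h.congr (Eventually.of_forall fun z ↦ (rfl : _ = conreyV φ L z))

/-- `√(y/2π) ≤ √T` when `y ≤ T + 7/2` and `T ≥ 1`. [folklore] -/
theorem sqrt_div_two_pi_le_sqrt {y T : ℝ} (hT : 1 ≤ T) (hy : y ≤ T + 7 / 2) :
    Real.sqrt (y / (2 * π)) ≤ Real.sqrt T := by
  have hπ := Real.pi_gt_three
  refine Real.sqrt_le_sqrt ?_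
  rw [div_le_iff₀ (by positivity)]
  nlinarith

/-- `(√T)^p = T^{p/2}` for `T ≥ 0`. [folklore] -/
theorem sqrt_rpow_eq {T : ℝ} (hT : 0 ≤ T) (p : ℝ) : Real.sqrt T ^ p = T ^ (p / 2) := by
  rw [Real.sqrt_eq_rpow, ← Real.rpow_mul hT]; congr 1; ring

/-- **Polynomial growth of `V` on the Backlund disc**: for `L ≥ 1`, `T ≥ 1200π` and
`|z − (5/2 + iT)| ≤ 5/2`,
`‖V(z)‖ ≤ (A₀ · 6·4⁶ + 15 (2π)⁵ · 4 · A₂ · 6·4⁵) · T⁴`,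
`A₀ = Σ |𝜙ₖ| k!`, `A₂ = Σ |𝜙̃ₖ| k!` (`𝜙̃ = 𝜙∘(1−X)`): on the disc `0 ≤ Re z ≤ 5`, so on the
circles `|w − z| = 1` one has `|Re w| ≤ 6` and `‖𝓡(w)‖ ≤ 6·4⁶ x₀^7 ≤ 6·4⁶ T^{7/2}`,
`‖K(w)‖ ≤ 6·4⁵ T³`, while `‖χ(z)‖ ≤ 15(2π)⁵(T + 3)`. [cite: Conrey1983, §4 (3)] -/
theorem norm_conreyV_le_of_mem_closedBall (φ : ℝ[X]) {L T : ℝ} (hL : 1 ≤ L) (hT : 1200 * π ≤ T)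
    {z : ℂ} (hz : z ∈ closedBall (((5 / 2 : ℝ) : ℂ) + T * I) (5 / 2)) :
    ‖conreyV φ L z‖ ≤
      ((∑ k ∈ φ.support, |φ.coeff k| * (k.factorial : ℝ)) * (6 * (4 : ℝ) ^ (6 : ℝ)) +
        15 * (2 * π) ^ (5 : ℝ) * 4 * (∑ k ∈ (φ.comp (1 - X)).support,
          |(φ.comp (1 - X)).coeff k| * (k.factorial : ℝ)) * (6 * (4 : ℝ) ^ (5 : ℝ))) * T ^ 4 := by
  have hπ := Real.pi_pos
  have hπ3 := Real.pi_gt_three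
  have hT1 : 1 ≤ T := by nlinarith
  set ψ : ℝ[X] := φ.comp (1 - X) with hψ
  set A₀ : ℝ := ∑ k ∈ φ.support, |φ.coeff k| * (k.factorial : ℝ) with hA₀
  set A₂ : ℝ := ∑ k ∈ ψ.support, |ψ.coeff k| * (k.factorial : ℝ) with hA₂
  have hA₀0 : 0 ≤ A₀ := Finset.sum_nonneg fun k _ ↦ by positivity
  have hA₂0 : 0 ≤ A₂ := Finset.sum_nonneg fun k _ ↦ by positivity
  -- coordinates of `z`
  rw [mem_closedBall_iff_norm] at hz
  have hre := Complex.abs_re_le_norm (z - (((5 / 2 : ℝ) : ℂ) + T * I))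
  have him := Complex.abs_im_le_norm (z - (((5 / 2 : ℝ) : ℂ) + T * I))
  simp only [sub_re, add_re, ofReal_re, mul_re, I_re, mul_zero, ofReal_im, I_im, mul_one,
    sub_self, add_zero, sub_im, add_im, mul_im, zero_add] at hre him
  obtain ⟨hz1, hz2⟩ := abs_le.1 (hre.trans hz)
  obtain ⟨hz3, hz4⟩ := abs_le.1 (him.trans hz)
  -- points of the circles `|w - z| = 1`
  have hcirc : ∀ w ∈ sphere z 1, -1 ≤ w.re ∧ w.re ≤ 6 ∧ T - 7 / 2 ≤ w.im ∧ w.im ≤ T + 7 / 2 := by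
    intro w hw
    rw [mem_sphere_iff_norm] at hw
    have h1 := Complex.abs_re_le_norm (w - z)
    have h2 := Complex.abs_im_le_norm (w - z)
    rw [hw, sub_re] at h1
    rw [hw, sub_im] at h2
    obtain ⟨h11, h12⟩ := abs_le.1 h1
    obtain ⟨h21, h22⟩ := abs_le.1 h2
    exact ⟨by linarith, by linarith, by linarith, by linarith⟩
  have hx24 : ∀ y : ℝ, T - 7 / 2 ≤ y → 24 ≤ Real.sqrt (y / (2 * π)) := by
    intro y hy
    rw [Real.le_sqrt (by norm_num) (by
      apply div_nonneg _ (by positivity); nlinarith), le_div_iff₀ (by positivity)]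
    nlinarith
  have hsqrtT : ∀ p : ℝ, 0 ≤ p → ∀ y : ℝ, y ≤ T + 7 / 2 → T - 7 / 2 ≤ y →
      Real.sqrt (y / (2 * π)) ^ p ≤ T ^ (p / 2) := by
    intro p hp y hy hy'
    rw [← sqrt_rpow_eq (by linarith) p]
    exact Real.rpow_le_rpow (Real.sqrt_nonneg _) (sqrt_div_two_pi_le_sqrt hT1 hy) hp
  -- `𝓡` on the circle
  have hR : ∀ w ∈ sphere z 1, ‖riemannAux w‖ ≤ 6 * (4 : ℝ) ^ (6 : ℝ) * T ^ (7 / 2 : ℝ) := by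
    intro w hw
    obtain ⟨h1, h2, h3, h4⟩ := hcirc w hw
    have h := norm_riemannAux_le_rpow (σ := w.re) (A := 6) (t := w.im) (abs_le.2 ⟨by linarith, h2⟩)
      (by nlinarith) (by linarith [hx24 w.im h3])
    rw [Complex.re_add_im] at h
    refine h.trans (mul_le_mul_of_nonneg_left ?_ (by positivity))
    have := hsqrtT (1 + 6) (by norm_num) w.im h4 h3
    refine this.trans (le_of_eq ?_)
    norm_num
  -- `K` on the circle
  have hK : ∀ w ∈ sphere z 1, ‖riemannAuxConj w‖ ≤ 6 * (4 : ℝ) ^ (5 : ℝ) * T ^ (3 : ℝ) := by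
    intro w hw
    obtain ⟨h1, h2, h3, h4⟩ := hcirc w hw
    rw [riemannAuxConj, Complex.norm_conj]
    have e : 1 - conj w = ((1 - w.re : ℝ) : ℂ) + w.im * I := by
      apply Complex.ext <;> simp
    rw [e]
    have h := norm_riemannAux_le_rpow (σ := 1 - w.re) (A := 5) (t := w.im)
      (abs_le.2 ⟨by linarith, by linarith⟩) (by nlinarith) (by linarith [hx24 w.im h3])
    refine h.trans (mul_le_mul_of_nonneg_left ?_ (by positivity))
    have := hsqrtT (1 + 5) (by norm_num) w.im h4 h3
    refine this.trans (le_of_eq ?_)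
    norm_num
  -- `χ(z)`
  have hχ : ‖rsChi z‖ ≤ 15 * (2 * π) ^ (5 : ℝ) * (T + 3) := by
    have h := norm_rsChi_le_of_re_nonneg (x := z.re) (y := z.im) (by linarith) (by nlinarith)
    rw [Complex.re_add_im] at h
    refine h.trans ?_
    have h1 : (2 * π) ^ z.re ≤ (2 * π) ^ (5 : ℝ) :=
      Real.rpow_le_rpow_of_exponent_le (by linarith) (by linarith)
    have h2 : z.im + 1 / 2 ≤ T + 3 := by linarith
    have h3 : 0 ≤ z.im + 1 / 2 := by nlinarith
    exact mul_le_mul (mul_le_mul_of_nonneg_left h1 (by norm_num)) h2 h3 (by positivity)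
  -- Cauchy transfer for the two operator terms
  have hP := norm_polyDerivOp_le φ (-L⁻¹) differentiable_riemannAux (s := z) one_pos hR
  have hD := norm_polyDerivOp_le ψ L⁻¹ differentiable_riemannAuxConj (s := z) one_pos hK
  have hB₀ : ∑ k ∈ φ.support, |φ.coeff k| * |(-L⁻¹)| ^ k * (k.factorial : ℝ) / (1 : ℝ) ^ k ≤ A₀ := by
    have := sum_coeff_inv_le φ hL
    simpa only [abs_neg] using this
  have hB₂ := sum_coeff_inv_le ψ hL
  have hP' : ‖polyDerivOp φ (-L⁻¹) riemannAux z‖ ≤ A₀ * (6 * (4 : ℝ) ^ (6 : ℝ) * T ^ (7 / 2 : ℝ)) :=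
    hP.trans (mul_le_mul_of_nonneg_right hB₀ (by positivity))
  have hD' : ‖polyDerivOp ψ L⁻¹ riemannAuxConj z‖ ≤ A₂ * (6 * (4 : ℝ) ^ (5 : ℝ) * T ^ (3 : ℝ)) :=
    hD.trans (mul_le_mul_of_nonneg_right hB₂ (by positivity))
  -- powers of `T`
  have hT72 : T ^ (7 / 2 : ℝ) ≤ T ^ 4 := by
    calc T ^ (7 / 2 : ℝ) ≤ T ^ (4 : ℝ) := Real.rpow_le_rpow_of_exponent_le hT1 (by norm_num)
      _ = T ^ 4 := by rw [← Real.rpow_natCast]; norm_num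
  have hT0 : (0 : ℝ) < T := by linarith
  have hT3 : (T + 3) * T ^ (3 : ℝ) ≤ 4 * T ^ 4 := by
    have e3 : T ^ (3 : ℝ) = T ^ (3 : ℕ) := by
      rw [← Real.rpow_natCast]
      norm_num
    rw [e3]
    have h13 : T + 3 ≤ 4 * T := by linarith
    calc (T + 3) * T ^ (3 : ℕ) ≤ (4 * T) * T ^ (3 : ℕ) :=
          mul_le_mul_of_nonneg_right h13 (pow_nonneg hT0.le 3)
      _ = 4 * T ^ 4 := by ring
  -- assemble
  rw [conreyV]
  refine (norm_add_le _ _).trans ?_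
  rw [norm_mul]
  have h6 : 0 ≤ 6 * (4 : ℝ) ^ (6 : ℝ) := by positivity
  have h5 : 0 ≤ 6 * (4 : ℝ) ^ (5 : ℝ) := by positivity
  calc ‖polyDerivOp φ (-L⁻¹) riemannAux z‖ + ‖rsChi z‖ * ‖polyDerivOp ψ L⁻¹ riemannAuxConj z‖
      ≤ A₀ * (6 * (4 : ℝ) ^ (6 : ℝ) * T ^ (7 / 2 : ℝ)) +
          (15 * (2 * π) ^ (5 : ℝ) * (T + 3)) * (A₂ * (6 * (4 : ℝ) ^ (5 : ℝ) * T ^ (3 : ℝ))) :=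
        add_le_add hP' (mul_le_mul hχ hD' (norm_nonneg _) (by positivity))
    _ = A₀ * (6 * (4 : ℝ) ^ (6 : ℝ)) * T ^ (7 / 2 : ℝ) +
          15 * (2 * π) ^ (5 : ℝ) * A₂ * (6 * (4 : ℝ) ^ (5 : ℝ)) * ((T + 3) * T ^ (3 : ℝ)) := by ring
    _ ≤ A₀ * (6 * (4 : ℝ) ^ (6 : ℝ)) * T ^ 4 +
          15 * (2 * π) ^ (5 : ℝ) * A₂ * (6 * (4 : ℝ) ^ (5 : ℝ)) * (4 * T ^ 4) := by
        gcongr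
    _ = (A₀ * (6 * (4 : ℝ) ^ (6 : ℝ)) + 15 * (2 * π) ^ (5 : ℝ) * 4 * A₂ * (6 * (4 : ℝ) ^ (5 : ℝ))) * T ^ 4 := by
        ring

/-- **Backlund bound for `V` on the horizontal edges** (Conrey 1983, §4 (3); Titchmarsh §9.4): for
a real polynomial `𝜙` with `𝜙(0) ≠ 0` there are `L₀ ≥ 1`, `T₀ > 0` and `C > 0` such that for all
`L ≥ L₀` and `T ≥ T₀`, if `V = conreyV 𝜙 L` does not vanish on the segment `[½, 5/2] × {T}`, then
`|Im ∫_{1/2}^{5/2} (V'/V)(x + iT) dx| ≤ C log T`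
(Backlund's lemma on the discs `|z − (5/2+iT)| ≤ 2 < 5/2` with `‖V‖ ≤ C_𝜙 T⁴` and the centre value
`|V(5/2+iT)| ≥ |𝜙(0)|/6`). [cite: Conrey1983, §4 (3)] -/
theorem conreyV_horizontal_argVariation (φ : ℝ[X]) (hφ : φ.coeff 0 ≠ 0) :
    ∃ L₀ T₀ C : ℝ, 1 ≤ L₀ ∧ 0 < T₀ ∧ 0 < C ∧ ∀ L : ℝ, L₀ ≤ L → ∀ T : ℝ, T₀ ≤ T →
      (∀ x ∈ Icc (1 / 2 : ℝ) (5 / 2), conreyV φ L (x + T * I) ≠ 0) →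
        |(∫ x : ℝ in (1 / 2 : ℝ)..(5 / 2), deriv (conreyV φ L) (x + T * I) /
            conreyV φ L (x + T * I)).im| ≤ C * Real.log T := by
  have hπ := Real.pi_pos
  have hπ3 := Real.pi_gt_three
  obtain ⟨L₀, T₀, hL₀, hT₀, hedge⟩ := conreyV_rightEdge φ hφ
  set ψ : ℝ[X] := φ.comp (1 - X) with hψ
  set C₁ : ℝ := (∑ k ∈ φ.support, |φ.coeff k| * (k.factorial : ℝ)) * (6 * (4 : ℝ) ^ (6 : ℝ)) +
    15 * (2 * π) ^ (5 : ℝ) * 4 * (∑ k ∈ ψ.support, |ψ.coeff k| * (k.factorial : ℝ)) * (6 * (4 : ℝ) ^ (5 : ℝ)) + 1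
    with hC₁
  have hA₀0 : 0 ≤ ∑ k ∈ φ.support, |φ.coeff k| * (k.factorial : ℝ) := Finset.sum_nonneg fun k _ ↦ by positivity
  have hA₂0 : 0 ≤ ∑ k ∈ ψ.support, |ψ.coeff k| * (k.factorial : ℝ) := Finset.sum_nonneg fun k _ ↦ by positivity
  have h46 : (0 : ℝ) ≤ 6 * (4 : ℝ) ^ (6 : ℝ) := by positivity
  have h45 : (0 : ℝ) ≤ 6 * (4 : ℝ) ^ (5 : ℝ) := by positivity
  have h2π5 : (0 : ℝ) ≤ 15 * (2 * π) ^ (5 : ℝ) * 4 := by positivity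
  have hC₁1 : 1 ≤ C₁ := by
    rw [hC₁]
    have h1 := mul_nonneg hA₀0 h46
    have h2 := mul_nonneg (mul_nonneg h2π5 hA₂0) h45
    linarith
  set c₀ : ℝ := |φ.coeff 0| / 6 with hc₀
  have hc₀0 : 0 < c₀ := by rw [hc₀]; have := abs_pos.2 hφ; positivity
  -- the constant: `π ((log C₁ + 4 log T + |log c₀|)/log(5/4) + 1) ≤ C log T` for `log T ≥ 1`
  set C : ℝ := π * ((Real.log C₁ + 4 + |Real.log c₀|) / Real.log (5 / 4) + 1) with hC
  have hlog54 : 0 < Real.log (5 / 4) := Real.log_pos (by norm_num)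
  have hlogC₁ : 0 ≤ Real.log C₁ := Real.log_nonneg hC₁1
  have hCpos : 0 < C := by rw [hC]; positivity
  refine ⟨L₀, max T₀ (1200 * π), C, hL₀, lt_max_of_lt_left hT₀, hCpos, fun L hL T hT h0 ↦ ?_⟩
  have hT₀T : T₀ ≤ T := le_trans (le_max_left _ _) hT
  have hT1200 : 1200 * π ≤ T := le_trans (le_max_right _ _) hT
  have hL1 : 1 ≤ L := le_trans hL₀ hL
  have hT1 : 1 ≤ T := by nlinarith
  have hlogT : 1 ≤ Real.log T := by
    rw [← Real.log_exp 1]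
    refine Real.log_le_log (Real.exp_pos 1) ?_
    have := Real.exp_one_lt_d9
    nlinarith
  -- Backlund's lemma
  set M : ℝ := C₁ * T ^ 4 with hM
  have hM1 : 1 ≤ M := by
    rw [hM]; nlinarith [one_le_pow₀ (n := 4) hT1]
  have hcentre : c₀ ≤ ‖conreyV φ L (((5 / 2 : ℝ) : ℂ) + T * I)‖ :=
    norm_conreyV_ge_of_norm_sub_le (hedge L hL T hT₀T)
  have hc : conreyV φ L (((5 / 2 : ℝ) : ℂ) + T * I) ≠ 0 := by
    intro h; rw [h, norm_zero] at hcentre; linarith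
  have hB := abs_im_integral_logDeriv_le_backlund (g := conreyV φ L) (c := (5 / 2 : ℝ)) (y := T)
    (r := 2) (R := 5 / 2) (M := M) (a := 1 / 2) (b := 5 / 2) (by norm_num) (by norm_num) hM1
    (fun z hz ↦ analyticAt_conreyV_of_im_ne_zero φ L (by
      rw [mem_closedBall_iff_norm] at hz
      have him := Complex.abs_im_le_norm (z - (((5 / 2 : ℝ) : ℂ) + T * I))
      simp only [sub_im, add_im, ofReal_im, mul_im, ofReal_re, I_im, mul_one, I_re, mul_zero,
        add_zero, zero_add] at him
      have := (abs_le.1 (him.trans hz)).1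
      intro h0; rw [h0] at this; nlinarith))
    (fun z hz ↦ by
      rw [hM]
      refine (norm_conreyV_le_of_mem_closedBall φ hL1 hT1200 hz).trans ?_
      rw [hC₁]
      have hT4 : 0 ≤ T ^ 4 := by positivity
      nlinarith)
    hc (by norm_num) (by norm_num) (by norm_num) h0
  refine hB.trans ?_
  -- `log (M/‖V(5/2+iT)‖) ≤ log C₁ + 4 log T + |log c₀|`
  have hVpos : 0 < ‖conreyV φ L (((5 / 2 : ℝ) : ℂ) + T * I)‖ := lt_of_lt_of_le hc₀0 hcentre
  have hlogM : Real.log (M / ‖conreyV φ L (((5 / 2 : ℝ) : ℂ) + T * I)‖) ≤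
      Real.log C₁ + 4 * Real.log T + |Real.log c₀| := by
    have h1 : M / ‖conreyV φ L (((5 / 2 : ℝ) : ℂ) + T * I)‖ ≤ M / c₀ :=
      div_le_div_of_nonneg_left (by linarith) hc₀0 hcentre
    calc Real.log (M / ‖conreyV φ L (((5 / 2 : ℝ) : ℂ) + T * I)‖) ≤ Real.log (M / c₀) :=
          Real.log_le_log (by positivity) h1
      _ = Real.log C₁ + 4 * Real.log T - Real.log c₀ := by
          rw [Real.log_div (by positivity) hc₀0.ne', hM, Real.log_mul (by positivity) (by positivity),
            Real.log_pow]; push_cast; ring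
      _ ≤ Real.log C₁ + 4 * Real.log T + |Real.log c₀| := by linarith [neg_abs_le (Real.log c₀)]
  have hquot : Real.log (M / ‖conreyV φ L (((5 / 2 : ℝ) : ℂ) + T * I)‖) / Real.log ((5 / 2) / 2) + 1 ≤
      ((Real.log C₁ + 4 + |Real.log c₀|) / Real.log (5 / 4) + 1) * Real.log T := by
    rw [show ((5 : ℝ) / 2) / 2 = 5 / 4 by norm_num]
    have h1 : Real.log (M / ‖conreyV φ L (((5 / 2 : ℝ) : ℂ) + T * I)‖) / Real.log (5 / 4) ≤
        (Real.log C₁ + 4 * Real.log T + |Real.log c₀|) / Real.log (5 / 4) :=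
      div_le_div_of_nonneg_right hlogM hlog54.le
    have h2 : Real.log C₁ + 4 * Real.log T + |Real.log c₀| ≤
        (Real.log C₁ + 4 + |Real.log c₀|) * Real.log T := by
      nlinarith [abs_nonneg (Real.log c₀)]
    have h3 : (Real.log C₁ + 4 * Real.log T + |Real.log c₀|) / Real.log (5 / 4) ≤
        (Real.log C₁ + 4 + |Real.log c₀|) / Real.log (5 / 4) * Real.log T := by
      rw [div_mul_eq_mul_div]; exact div_le_div_of_nonneg_right h2 hlog54.le
    nlinarith
  rw [hC, mul_assoc]
  exact mul_le_mul_of_nonneg_left hquot hπ.le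

end Literature.NumberTheory.LFunctions

end
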